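/-
Copyright (c) 2026 the pub-hodgecm-mathlib formalisation cell (harness21).  Prover seat hodgecm-mathlib-K2Liu-p10 (g5), Track B «K2-LIT»,
#184♮ = hLiu418 = `stmt-HodgeConjecture-24832`; (σ) endgame organ, socket σ-9r: the letter `hu` of the face at a RAMIFIED non-split place
(K2Liu-p09 (g7) 16:18:28Z «a separate S letter: `¬ (quadraticHeckeCharCM L).IsUnramifiedAt v` at `v ∣ 𝔡_{L∕L⁺}` … OWNER WANTED (p10 lineage natural)»).
-/
import Summits.HodgeConjecture.HodgeConjecture.Theorems.K2LiuA7ValueSocketHu            -- ★ σ-9: `chiF_localComponent_pow_eq_quadraticHeckeCharCM`, `isUnramifiedChar_localComponent_iff`, `hu_three_ne_one_of_inert`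
import Summits.HodgeConjecture.HodgeConjecture.Theorems.K2LiuRamifiedUnitNonNorm          -- ★ (q4′): `exists_valuation_norm_eq_exp_neg_one`, `hilbertSymbol_norm_eq_one`
import Literature.NumberTheory.Automorphic.QuadraticHeckeCharacterLocalComponent          -- ★ `quadraticHeckeChar_localUnits_eq_one_iff_mem`
import Literature.NumberTheory.QuadraticForms.LocalNormIndex                              -- ★ `index_quadraticNormSubgroup_adicCompletion_eq_two` (O'Meara 63:13a, CFT-free)
import Literature.NumberTheory.Automorphic.Liu2021.LemD1AsPrintedIndexedNonVacuityNonsplitPlace  -- ★ `not_isSquare_delta_sq_of_nonsplit`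
import HarnessLib

/-!
# Crux `HLiu418`, (σ) endgame, σ-9r: `ε_{L∕L⁺}` IS RAMIFIED AT A RAMIFIED PLACE, AND THE LETTER `hu` AT EVERY NON-SPLIT PLACE

Cell `hodgecm-mathlib`, crux item hLiu418 = `stmt-HodgeConjecture-24832`, route of record `HCCMUnconditional`; squad K2 ∕ K2Liu, prover K2Liu-p10 (g5); organ lead
K2Liu-p09 (g7) (face `faceA4R_two_of_record_v7` ★ p861760 takes `hu : unramValue (Fp L) v (chiF … (fun w => (χ ^ 3).localComponent w.1)) ≠ 1` BY VALUE; v8 📤 p861843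
discharges it at an inert unramified place by ★ σ-9).  THEOREMS ONLY; lane `--supports stmt-HodgeConjecture-24832 --as helper`.

* §1 **`not_isUnramifiedAt_quadraticHeckeCharCM_of_ramified`** — at a finite place `v` of `L⁺` with a conjugation-fixed place `w ∣ v` and `v` RAMIFIED in `L`, the
  quadratic character `ε = ε_{L∕L⁺}` is ramified at `v`.  CFT-free proof: were `ε_v` trivial on `𝒪_vˣ`, every `v`-unit would be a local norm from `L_w = L⁺_v(√θ)`
  (`ε(⟨u⟩_v) = 1 ↔ u ∈ N := {x² − θy²}`, ★ `quadraticHeckeChar_localUnits_eq_one_iff_mem`); the norm of a `w`-uniformiser is a `v`-UNIFORMISER lying in `N`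
  (`f(w∣v) = 1`, ★ `exists_valuation_norm_eq_exp_neg_one`, ★ `hilbertSymbol_norm_eq_one`); units and one uniformiser generate `L⁺_vˣ`, so `N = L⁺_vˣ` — but
  `(L⁺_vˣ : N) = 2` since `θ` is a non-square at the non-split `v` (★ `index_quadraticNormSubgroup_adicCompletion_eq_two`, ★ `not_isSquare_delta_sq_of_nonsplit`).
* §2 **`unramValue_chiF_localComponent_pow_of_ramified`** (`= 0`, the «dead L-factor» value of a ramified character, ★ `unramValue_of_not`), **`hu_ne_one_of_ramified`**,
  **`hu_three_ne_one_of_ramified`**, and the case-free **`hu_three_ne_one_of_nonsplit L v w hw hχs`** (inert: `−1 ≠ 1` by ★ σ-9; ramified: `0 ≠ 1`) — one edition of the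
  face serves every non-split `v`.

HONEST LABEL: HC_CM is proved only modulo the 7 printed citations (2 remaining named inputs: hLiu418 = stmt-HodgeConjecture-24832, h413 = stmt-HodgeConjecture-24833)
until rung 0 closes; helper, closes no item.
References: [NeukirchANT1999] Ch. V §1 (1.2) (norm groups: `(U_K : N U_L) = e`), Ch. VII §6 (6.10)–(6.11); [Omeara1963] §63B 63:13a, §63C 63:16, §65A;
[HarrisKudlaSweet1996] §6 (6.16); [CasselsFrohlichANT1967] Ch. VI (Tate) §2.5, Ch. VII Prop. 1.2.
-/

set_option autoImplicit false
set_option linter.dupNamespace false -- the mandated namespace repeats `HodgeConjecture.HodgeConjecture`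

noncomputable section

open NumberField IsDedekindDomain
open Literature.NumberTheory.GaloisRepresentations Literature.NumberTheory.QuadraticForms Literature.NumberTheory.NumberFields
open Literature.NumberTheory.Automorphic Literature.NumberTheory.Automorphic.UnitaryGroup
open Literature.RepresentationTheory.HarrisKudlaSweet1996
open Literature.NumberTheory.Automorphic.Liu2021.LemD1IndexedNonVacuityNonsplitPlace (not_isSquare_delta_sq_of_nonsplit)
open Summit.HodgeConjecture.HodgeConjecture.Cruxes.HLiu418.K2LiuLocalLFactorDefs
open Summit.HodgeConjecture.HodgeConjecture.Cruxes.HLiu418.K2LiuRamifiedUnitNonNorm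
open Summit.HodgeConjecture.HodgeConjecture.Cruxes.HLiu418.K2LiuA7ValueSocketHu

namespace Summit.HodgeConjecture.HodgeConjecture.Cruxes.HLiu418.K2LiuA7ValueSocketHuRamified

variable (L : Type) [Field L] [NumberField L] [IsCMField L] (v : HeightOneSpectrum (𝓞 ↥(maximalRealSubfield L)))
  (w : PlacesOver L v) (hw : IsCMField.complexConj L • w.1 = w.1)

/-! ## §1 `ε_{L∕L⁺}` is ramified at every place ramified in `L∕L⁺` -/

include hw in
/-- **`ε_{L∕L⁺}` IS RAMIFIED AT A RAMIFIED PLACE**: for a finite place `v` of `L⁺` with a conjugation-fixed place `w ∣ v` and `v` ramified in `L`,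
`¬ ε.IsUnramifiedAt v` (`(𝒪_vˣ : N_{L_w∕L⁺_v} 𝒪_wˣ) = e = 2`).  CFT-free: units ⊆ norms and a norm uniformiser would force `N(L_wˣ) = L⁺_vˣ`, of index `2`.
[cite: NeukirchANT1999, Ch. V §1 (1.2)] [cite: Omeara1963, §63B 63:13a] -/
theorem not_isUnramifiedAt_quadraticHeckeCharCM_of_ramified (hram : ¬ Algebra.IsUnramifiedIn (𝓞 L) v.asIdeal) :
    ¬ (quadraticHeckeCharCM L).IsUnramifiedAt v := by
  intro hU
  haveI : Algebra.IsQuadraticExtension ↥(maximalRealSubfield L) L := IsCMField.isQuadraticExtension L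
  set Kv := v.adicCompletion ↥(maximalRealSubfield L) with hKv
  haveI : CharZero Kv := charZero_of_injective_algebraMap (algebraMap ↥(maximalRealSubfield L) Kv).injective
  haveI : NeZero (2 : Kv) := ⟨two_ne_zero⟩
  obtain ⟨α, hα0, hcα, hsq⟩ := cmQuadraticGenerator_spec L
  set θ : ↥(maximalRealSubfield L) := ((cmQuadraticGenerator L : 𝓞 ↥(maximalRealSubfield L)) : ↥(maximalRealSubfield L)) with hθdef
  have hθ : α * α = algebraMap ↥(maximalRealSubfield L) L θ := by rw [← sq]; exact hsq
  have hθ0 : θ ≠ 0 := fun h => by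
    rw [h, map_zero, sq_eq_zero_iff] at hsq
    exact hα0 hsq
  have hθK0 : algebraMap ↥(maximalRealSubfield L) Kv θ ≠ 0 := (map_ne_zero _).2 hθ0
  -- `θ` is a non-square at the non-split place `v`, so `N := N(L_wˣ) = {x² − θy²}` has index `2` in `L⁺_vˣ`
  have hnsq : ¬ IsSquare (algebraMap ↥(maximalRealSubfield L) Kv θ) :=
    not_isSquare_delta_sq_of_nonsplit L v (IsCMField.complexConj L) hcα hα0 w hw hθ
  set N : Subgroup Kvˣ := quadraticNormSubgroup Kv (algebraMap ↥(maximalRealSubfield L) Kv θ) with hN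
  have hidx : N.index = 2 := index_quadraticNormSubgroup_adicCompletion_eq_two ↥(maximalRealSubfield L) v hθK0 hnsq
  -- every `v`-unit is a local norm (this is where `hU` is used)
  have hUc : IsUnramifiedChar ((quadraticHeckeCharCM L).localComponent v) := (isUnramifiedChar_localComponent_iff L v _).2 hU
  have hunits : ∀ u : Kvˣ, Valued.v (u : Kv) = 1 → u ∈ N := by
    intro u hu
    have h1 := hUc u hu
    rw [HeckeCharacter.localComponent_apply, quadraticHeckeCharCM_def,
      quadraticHeckeChar_localUnits_eq_one_iff_mem (not_isSquare_cmQuadraticGenerator L) v u] at h1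
    exact h1
  -- `w` is the only place above `v`; the norm of a `w`-uniformiser is a `v`-uniformiser which is a local norm
  have hfw : finitePlacesOver L v = {w.1} := by
    haveI : Subsingleton (PlacesOver L v) :=
      PlacesOver.subsingleton_of_smul_eq (IsCMField.complexConj L) (IsCMField.complexConj_ne_one L) w hw
    refine Set.eq_singleton_iff_unique_mem.2 ⟨w.2, fun w' hw' => ?_⟩
    exact congrArg Subtype.val (Subsingleton.elim (⟨w', hw'⟩ : PlacesOver L v) w)
  obtain ⟨z, hz0, hvz⟩ := exists_valuation_norm_eq_exp_neg_one (K := ↥(maximalRealSubfield L)) (E := L) hram hfw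
  set p : ↥(maximalRealSubfield L) := Algebra.norm ↥(maximalRealSubfield L) z with hp
  have hp0 : p ≠ 0 := Algebra.norm_ne_zero_iff.2 hz0
  have hpK0 : algebraMap ↥(maximalRealSubfield L) Kv p ≠ 0 := (map_ne_zero _).2 hp0
  set P : Kvˣ := Units.mk0 (algebraMap ↥(maximalRealSubfield L) Kv p) hpK0 with hP
  have hPN : P ∈ N := by
    rw [← hilbertSymbol_eq_one_iff_mem_quadraticNormSubgroup hθK0, hP, Units.val_mk0, hilbertSymbol_comm]
    exact hilbertSymbol_norm_eq_one hcα hα0 hsq v hz0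
  have hvP : Valued.v ((P : Kvˣ) : Kv) = WithZero.exp (-1 : ℤ) :=
    (HeightOneSpectrum.valuedAdicCompletion_eq_valuation' v p).trans hvz
  -- units and `P` generate `L⁺_vˣ`: `N = ⊤`
  have htop : N = ⊤ := by
    rw [eq_top_iff]
    rintro x -
    set m : ℤ := WithZero.log (Valued.v ((x : Kvˣ) : Kv)) with hm
    have hx0 : Valued.v ((x : Kvˣ) : Kv) ≠ 0 := (Valuation.ne_zero_iff _).2 x.ne_zero
    have hvx : Valued.v ((x : Kvˣ) : Kv) = WithZero.exp m := by rw [hm, WithZero.exp_log hx0]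
    have hu1 : Valued.v ((x * P ^ m : Kvˣ) : Kv) = 1 := by
      rw [Units.val_mul, map_mul, Units.val_zpow_eq_zpow_val, map_zpow₀, hvP, hvx, ← WithZero.exp_zsmul, ← WithZero.exp_add,
        smul_eq_mul, mul_neg, mul_one, add_neg_cancel, WithZero.exp_zero]
    have hmem : x * P ^ m ∈ N := hunits _ hu1
    have h := N.mul_mem hmem (N.zpow_mem hPN (-m))
    rwa [mul_assoc, ← zpow_add, add_neg_cancel, zpow_zero, mul_one] at h
  rw [htop, Subgroup.index_top] at hidx
  exact absurd hidx (by norm_num)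

include hw in
/-- the dichotomy at a non-split place: `ε` is unramified at `v` iff `v` is unramified in `L∕L⁺` (★ `isUnramifiedAt_quadraticHeckeCharCM_of_isUnramifiedIn` and §1).
[cite: NeukirchANT1999, Ch. V §1 (1.2)] [cite: Omeara1963, §63C Example 63:16] -/
theorem isUnramifiedAt_quadraticHeckeCharCM_iff_of_nonsplit :
    (quadraticHeckeCharCM L).IsUnramifiedAt v ↔ Algebra.IsUnramifiedIn (𝓞 L) v.asIdeal :=
  ⟨fun h => by_contra fun hram => not_isUnramifiedAt_quadraticHeckeCharCM_of_ramified L v w hw hram h,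
    Literature.NumberTheory.Rogawski1990.isUnramifiedAt_quadraticHeckeCharCM_of_isUnramifiedIn L⟩

/-! ## §2 `hu` at a ramified place, and at every non-split place -/

include hw in
/-- **`unramValue (χ_{F,v}) = 0`** for `χ_v := ((χ^k)_w)_w`, `χ` a splitting character, `k` odd, at a non-split place `v` RAMIFIED in `L∕L⁺` (`χ_{F,v} = ε_v` is ramified;
the «dead L-factor» convention). [cite: HarrisKudlaSweet1996, §6 (6.16)] [cite: NeukirchANT1999, Ch. V §1 (1.2)] -/
theorem unramValue_chiF_localComponent_pow_of_ramified {χ : HeckeCharacter L} (hχs : IsSplittingChar L 1 χ) {k : ℕ} (hk : Odd k)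
    (hram : ¬ Algebra.IsUnramifiedIn (𝓞 L) v.asIdeal) :
    unramValue (↥(maximalRealSubfield L)) v (chiF (↥(maximalRealSubfield L)) L v (fun w' : PlacesOver L v => (χ ^ k).localComponent w'.1)) = 0 := by
  rw [chiF_localComponent_pow_eq_quadraticHeckeCharCM L v w hw hχs hk]
  exact unramValue_of_not (↥(maximalRealSubfield L)) v fun h =>
    not_isUnramifiedAt_quadraticHeckeCharCM_of_ramified L v w hw hram ((isUnramifiedChar_localComponent_iff L v _).1 h)

include hw in
/-- **`hu` AT A RAMIFIED PLACE**: `unramValue (chiF (Fp L) L v (fun w => (χ ^ k).localComponent w.1)) ≠ 1` (`= 0`), `k` odd.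
[cite: HarrisKudlaSweet1996, §6 (6.16)] -/
theorem hu_ne_one_of_ramified {χ : HeckeCharacter L} (hχs : IsSplittingChar L 1 χ) {k : ℕ} (hk : Odd k) (hram : ¬ Algebra.IsUnramifiedIn (𝓞 L) v.asIdeal) :
    unramValue (↥(maximalRealSubfield L)) v (chiF (↥(maximalRealSubfield L)) L v (fun w' : PlacesOver L v => (χ ^ k).localComponent w'.1)) ≠ 1 := by
  rw [unramValue_chiF_localComponent_pow_of_ramified L v w hw hχs hk hram]
  exact zero_ne_one

include hw in
/-- the face's literal instance `k = 3` at a ramified place. [cite: HarrisKudlaSweet1996, §6 (6.16)] -/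
theorem hu_three_ne_one_of_ramified {χ : HeckeCharacter L} (hχs : IsSplittingChar L 1 χ) (hram : ¬ Algebra.IsUnramifiedIn (𝓞 L) v.asIdeal) :
    unramValue (↥(maximalRealSubfield L)) v (chiF (↥(maximalRealSubfield L)) L v (fun w' : PlacesOver L v => (χ ^ 3).localComponent w'.1)) ≠ 1 :=
  hu_ne_one_of_ramified L v w hw hχs (by decide) hram

include hw in
/-- **THE FACE's `hu` AT EVERY NON-SPLIT PLACE** (`k` odd): inert unramified `⇒ −1 ≠ 1` (★ σ-9), ramified `⇒ 0 ≠ 1` (§2). [cite: HarrisKudlaSweet1996, §6 (6.16)] -/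
theorem hu_ne_one_of_nonsplit {χ : HeckeCharacter L} (hχs : IsSplittingChar L 1 χ) {k : ℕ} (hk : Odd k) :
    unramValue (↥(maximalRealSubfield L)) v (chiF (↥(maximalRealSubfield L)) L v (fun w' : PlacesOver L v => (χ ^ k).localComponent w'.1)) ≠ 1 := by
  by_cases hunr : Algebra.IsUnramifiedIn (𝓞 L) v.asIdeal
  · exact hu_ne_one_of_inert L v w hw hχs hk hunr
  · exact hu_ne_one_of_ramified L v w hw hχs hk hunr

include hw in
/-- **THE FACE's `hu`, literal instance `k = 3`, AT EVERY NON-SPLIT PLACE** — one edition of `faceA4R_two_of_record` for inert and ramified `v` alike.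
[cite: HarrisKudlaSweet1996, §6 (6.16)] -/
theorem hu_three_ne_one_of_nonsplit {χ : HeckeCharacter L} (hχs : IsSplittingChar L 1 χ) :
    unramValue (↥(maximalRealSubfield L)) v (chiF (↥(maximalRealSubfield L)) L v (fun w' : PlacesOver L v => (χ ^ 3).localComponent w'.1)) ≠ 1 :=
  hu_ne_one_of_nonsplit L v w hw hχs (by decide)

end Summit.HodgeConjecture.HodgeConjecture.Cruxes.HLiu418.K2LiuA7ValueSocketHuRamified

end
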